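import Literature.Computability.QuantumComplexity.PermanentSearchRuns
import Literature.Computability.QuantumComplexity.PermanentHardness
import Literature.Computability.Complexity.OracleQueryMap
import Literature.Computability.Complexity.UniformProbBlocks
import Literature.Computability.Complexity.CoinCounting
import HarnessLib

/-!
# `P^{#P} ⊆ BPP^O` for a randomised `Per²`-approximator: AA13 Thm. 4.3 from Valiant's theorem

Aaronson–Arkhipov, *The computational complexity of linear optics*, Theory of Computing 9 (2013),
prove `P^{#P} ⊆ BPP^{NP^𝒪}` for an exact BosonSampling oracle `𝒪` (Thm. 1.1, proof p. 178) by
(i) Valiant's theorem (Thm. 4.2: the `0/1` permanent is `#P`-complete), (ii) Thm. 4.3: an oracle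
approximating `Per(X)²` within a factor `g` lets one compute `Per X` of a `0/1` matrix exactly with
`O(g n² log n)` adaptive queries (a binary search), and (iii) Stockmeyer counting (Thm. 4.1), which
provides such an approximator in `FBPP^{NP^𝒪}` — a *randomised* one, so that composing (ii) with it
("it suffices to show how to approximate `Per(X)²` in `FBPP^{NP^𝒪}`", p. 178) is a randomised
reduction: the `BPP` machine supplies fresh coins to every oracle call and a union bound over the
polynomially many calls controls the error (the randomised oracle being "a deterministic algorithm
that takes a random string as part of its input", Thm. 1.1, p. 149; Arora–Barak 2009, §7.4.1).

The tree records (ii)+(composition) as the named fact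
`PSharpP_subset_BPPRel_of_perSqRandOracleSolves` (`ExactBosonSamplingHardness.lean`): every
coin-taking oracle `O` that `g`-approximates `Per²` of integer matrices (`PerSqRandOracleSolves g O`)
gives `P^{#P} ⊆ BPP^O`. **This file proves that fact from Valiant's theorem
(`permanent01_isSharpPHardFun`, `PermanentHardness.lean`) and one running-time fact**
(`PerSearch.randSearchAlg_isPolyTime`: the transcript step function of the search is polynomial-time
on a Turing machine), the mathematics being proved in `PermanentSearch.lean` (the search and its
correctness on good runs, `perLevel_correct`), `PermanentSearchRuns.lean` (query/size bounds,
distinct call sites) and here: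

* `PerSearch.randComp` / `randSearchAlg` / `randFn` — the randomised search on a decorated query
  `u = ⟨⟨x, r⟩, ⟨listBool as, y⟩⟩`: the search `perLevel canon G n X` for the `0/1` matrix `X` coded
  by `y`, its canonical queries relabelled (`OracleComp.relabel`) by the coin map `coinMap`, which
  turns the query at call site `s` of sub-run `i = |as|` into the `Per²`-query
  `⟨⟨M, 1^k⟩, block_{i·NS + siteIdx s}(r)⟩`; `randFn_mem_FPRel`: it computes an `FP^O` function
  (polynomially many, polynomially long queries: `queryCount_randComp_le`,
  `length_le_of_mem_queryList_randComp`);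
* `PerSearch.Kalg` / `Lrand` — the deterministic part of the `BPP^O` machine: the `P^{Per}` machine
  `M₀` with capped, decorated queries, clocked (`OracleQueryMap.lean`); `Lrand_mem_PRel` and, by
  oracle composition (`OracleCompositionMachine.lean`), `Lrand_mem_PRel_oracle : Lrand ∈ P^O`;
* good coins: `GoodCoins`, `randFn_eq_of_goodRun` (on a good run the search answers as the exact
  permanent oracle), `mapAgree_of_goodCoins`, `run_Kalg_of_goodCoins`,
  `mem_Lrand_iff_of_goodCoins` (`⟨x, r⟩ ∈ Lrand ↔ x ∈ L`);
* bad coins are rare: `matrix_eq_of_agree` (coins agreeing outside the block of a call site lead to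
  the same matrix at that site — prefix agreement + distinct sites), `BadBlock`,
  `uniformProb_badBlock_le` (`≤ 1/k` per block, from the oracle's guarantee),
  `uniformProb_not_goodCoins_le` (`≤ #blocks/k = 1/3`, `UniformProbBlocks.lean`);
* assembly: `PerSearch.PRel_per01Fn_subset_BPPRel`,
  `PSharpP_subset_BPPRel_of_perSqRandOracleSolves_of_facts` (the named fact from `hVal` and `hPT`;
  real factors `g` are rounded up to `⌈g⌉`), and the corrected S20
  `PSharpP_subset_BPPRelClass_NP_of_uniformExactBosonSampling_of_AA13` from exactly
  `stockmeyerApproxCounting`, `permanent01_isSharpPHardFun`, `randSearchAlg_isPolyTime`,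
  `bosonReduction_mem_FP`.

The one named fact introduced here is `PerSearch.randSearchAlg_isPolyTime` (see its docstring).

Librarian note (hoist set). The opening block is generic trunk material declared in `Literature.CplxCore`
but living in this `QuantumComplexity` file: `OracleAlg.exists_step_of_mem_queriesAux` /
`exists_step_of_mem_queries`, `OracleAlg.trans_comap`, `OracleAlg.length_trans`,
`OracleAlg.length_qryOf_capQ_le` (destined for `Complexity/OracleQueryMap.lean`),
`uniformProb_mono_of_length'` (twin of `uniformProb_mono_of_length` of
`PostBPPAmplification.lean`; both destined for `Randomized.lean`) and
`length_eq_of_listBoolDecode_eq_some` (for `BoolEncodings.lean`); likewise the arithmetic helpers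
`PerSearch.radix_inj`, `PerSearch.factorial_lt_two_pow_sq_succ`, `PerSearch.encodeNat_zero` (twin of
`encodeNat_zero'` of `TokenStreams.lean`).

## References

* S. Aaronson, A. Arkhipov, *The computational complexity of linear optics*, Theory of Computing 9
  (2013), Thm. 1.1 (p. 149), Def. 2.4 (p. 163), Thm. 4.2–4.3 and proof (pp. 175–177), proof of
  Thm. 1.1 and Cor. 4.5 (p. 178).
* L. G. Valiant, *The complexity of computing the permanent*, Theoret. Comput. Sci. 8 (1979), Thm. 1.
* S. Arora, B. Barak, *Computational Complexity: A Modern Approach*, CUP 2009, §3.4 (oracle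
  machines), §7.4.1 (error reduction, union bound), §17.2 (`P^{#P}`), §0.1 (codes).
-/

namespace Literature.Computability.QuantumComplexity

open _root_.Computability

/-! ### Two generic facts on oracle algorithms -/

section OracleAlg
open Literature.Computability.Complexity (OracleAlg)
open Literature.Computability.Complexity.OracleAlg

variable {β : Type}

/-- **Every query arises from a step on a transcript of earlier answers**: if `y` is asked in the
run from `as`, then `M.step x as' = query y` for a transcript `as'` each of whose entries is an
entry of `as` or the oracle's answer to an earlier query of the same run. [Arora–Barak 2009, §3.4] [cite: AroraBarak2009, §3.4] -/
theorem _root_.Literature.Computability.Complexity.OracleAlg.exists_step_of_mem_queriesAux (M : OracleAlg β) (O : Complexity.Oracle) (x : List Bool) :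
    ∀ (n : ℕ) (as : List (List Bool)) (y : List Bool), y ∈ M.queriesAux O x n as →
      ∃ as', M.step x as' = Sum.inl y ∧ ∀ a ∈ as', a ∈ as ∨ ∃ y' ∈ M.queriesAux O x n as, a = O y'
  | 0, _, _, h => by simp at h
  | n + 1, as, y, h => by
    unfold queriesAux at h ⊢
    cases hs : M.step x as with
    | inr b => rw [hs] at h; simp at h
    | inl y₀ =>
      rw [hs] at h
      dsimp only at h ⊢
      rcases List.mem_cons.1 h with rfl | h
      · exact ⟨as, hs, fun a ha => Or.inl ha⟩
      · obtain ⟨as', hs', has'⟩ := exists_step_of_mem_queriesAux M O x n (as ++ [O y₀]) y h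
        refine ⟨as', hs', fun a ha => ?_⟩
        rcases has' a ha with ha | ⟨y', hy', rfl⟩
        · rcases List.mem_append.1 ha with ha | ha
          · exact Or.inl ha
          · exact Or.inr ⟨y₀, List.mem_cons_self, by simpa using ha⟩
        · exact Or.inr ⟨y', List.mem_cons_of_mem _ hy', rfl⟩

/-- The queries of a run from the empty transcript arise from steps on transcripts of answers to
earlier queries. [Arora–Barak 2009, §3.4] [cite: AroraBarak2009, §3.4] -/
theorem _root_.Literature.Computability.Complexity.OracleAlg.exists_step_of_mem_queries (M : OracleAlg β) (O : Complexity.Oracle) (n : ℕ) (x : List Bool) {y : List Bool}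
    (h : y ∈ M.queries O n x) :
    ∃ as', M.step x as' = Sum.inl y ∧ ∀ a ∈ as', ∃ y' ∈ M.queries O n x, a = O y' := by
  obtain ⟨as', hs, has⟩ := exists_step_of_mem_queriesAux M O x n [] y h
  exact ⟨as', hs, fun a ha => (has a ha).resolve_left (by simp)⟩

/-- The free-running transcript of `M.comap pre` on `w` is that of `M` on `pre w`. [folklore] -/
theorem _root_.Literature.Computability.Complexity.OracleAlg.trans_comap (M : OracleAlg β) (pre : List Bool → List Bool) (O : Complexity.Oracle) (w : List Bool) :
    ∀ i : ℕ, Complexity.PRelSigma.trans (M.comap pre) O w i = Complexity.PRelSigma.trans M O (pre w) i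
  | 0 => rfl
  | i + 1 => by
    rw [Complexity.PRelSigma.trans_succ, Complexity.PRelSigma.trans_succ, trans_comap M pre O w i]
    rfl

/-- The free-running transcript after `i` rounds has `i` entries. [folklore] -/
theorem _root_.Literature.Computability.Complexity.OracleAlg.length_trans (M : OracleAlg β) (O : Complexity.Oracle) (x : List Bool) : ∀ i : ℕ, (Complexity.PRelSigma.trans M O x i).length = i
  | 0 => rfl
  | i + 1 => by rw [Complexity.PRelSigma.trans_succ, List.length_append, length_trans M O x i]; rfl

/-- The junk-or-query `qryOf` of a capped algorithm obeys the cap. [folklore] -/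
theorem _root_.Literature.Computability.Complexity.OracleAlg.length_qryOf_capQ_le (M : OracleAlg β) (c : Polynomial ℕ) (b₀ : β) (x : List Bool) (as : List (List Bool)) :
    (Complexity.PRelSigma.qryOf (M.capQ c b₀) x as).length ≤ c.eval x.length := by
  unfold Complexity.PRelSigma.qryOf
  cases hs : (M.capQ c b₀).step x as with
  | inl y => exact capQ_step_eq_inl hs
  | inr b => simp

end OracleAlg

/-- Monotonicity of `uniformProb m` for events compared on the strings of length `m` only. (Same
statement as `uniformProb_mono_of_length` of `QuantumComplexity/PostBPPAmplification.lean`, which is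
not imported here — it would pull in the IQP development; librarian: hoist both into
`Randomized.lean`.) [folklore] -/
theorem uniformProb_mono_of_length' {m : ℕ} {E E' : Set (List Bool)}
    (h : ∀ y : List Bool, y.length = m → y ∈ E → y ∈ E') : Complexity.uniformProb m E ≤ Complexity.uniformProb m E' := by
  classical
  unfold Complexity.uniformProb
  refine div_le_div_of_nonneg_right ?_ (by positivity)
  exact_mod_cast Finset.card_le_card fun r hr => by
    simp only [Finset.mem_filter, Finset.mem_univ, true_and] at hr ⊢
    exact h _ (by simp) hr

/-- The number announced by a list code is the length of the decoded list. [folklore] -/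
theorem length_eq_of_listBoolDecode_eq_some {α : Type} (e : Encoding α Bool) :
    ∀ (n : ℕ) (w : List Bool) (l : List α), Complexity.listBoolDecode e n w = some l → l.length = n
  | 0, w, l, h => by simp [Complexity.listBoolDecode] at h; simp [← h]
  | n + 1, w, l, h => by
    simp only [Complexity.listBoolDecode, Option.pure_def, Option.bind_eq_bind, Option.bind_eq_some_iff, Option.some.injEq] at h
    obtain ⟨a, _, l', hl', rfl⟩ := h
    simp [length_eq_of_listBoolDecode_eq_some e n _ l' hl']

end Literature.Computability.QuantumComplexity

namespace Literature.Computability.QuantumComplexity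

open _root_.Computability Polynomial Complexity Complexity.Nondeterministic Complexity.OracleComp Matrix Finset

namespace PerSearch

/-- **A decodable matrix code is at least as long as the dimension** (the row count is announced in
unary inside the code). [folklore] -/
theorem dim_le_length_of_decode {w : List Bool} {M : Σ n : ℕ, Fin n → Fin n → ℤ}
    (h : encodingIntMatrix.decode w = some M) : M.1 ≤ w.length := by
  obtain ⟨n, X⟩ := M
  change sigmaBoolDecode (fun n => encodingFinVec (encodingFinVec encodingIntBool n) n) (decodeNat (boolUnpair w).1)
    (boolUnpair w).2 = some ⟨n, X⟩ at h
  simp only [sigmaBoolDecode, Option.map_eq_some_iff, Sigma.mk.injEq] at h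
  obtain ⟨X', hX', hn, _⟩ := h
  subst hn
  change ((encodingFinVec encodingIntBool (decodeNat (boolUnpair w).1)).listBool.decode (boolUnpair w).2).bind _ = some X' at hX'
  simp only [Option.bind_eq_some_iff] at hX'
  obtain ⟨l, hl, hlX⟩ := hX'
  split_ifs at hlX with hlen
  change listBoolDecode _ (unaryDecodeNat (boolUnpair (boolUnpair w).2).1) (boolUnpair (boolUnpair w).2).2 = some l at hl
  have h1 := length_eq_of_listBoolDecode_eq_some _ _ _ _ hl
  have h2 := length_boolUnpair_parts_le (boolUnpair w).2
  have h3 := length_boolUnpair_parts_le w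
  simp only [← hlen, h1, unaryDecodeNat]
  omega

/-! ### The parameters of the randomised search, as polynomials -/

section Params

variable (G : ℕ) (c q₀ : Polynomial ℕ)

/-- `RB g` as a polynomial. [folklore] -/
noncomputable def RBp : Polynomial ℕ := 2 * (X + 1) ^ 2 + C (2 * G + 3)

/-- `eval` of `RBp`. [folklore] -/
@[simp] theorem RBp_eval (n : ℕ) : (RBp G).eval n = RB G n := by simp [RBp, RB]; ring

/-- `EBits g` as a polynomial. [folklore] -/
noncomputable def EBitsp : Polynomial ℕ := (C (2 * G) + (X + 1) ^ 2) * RBp G + (RBp G + C G + (X + 1) ^ 2 + 1)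

/-- `eval` of `EBitsp`. [folklore] -/
@[simp] theorem EBitsp_eval (n : ℕ) : (EBitsp G).eval n = EBits G n := by simp [EBitsp, EBits]

/-- `LM n (EBits g n)` as a polynomial in `n`: the code length of the matrices asked. [folklore] -/
noncomputable def codeLenp : Polynomial ℕ :=
  2 * (X + 1) + 2 + (2 * X + 2 + X * (2 * (2 * X + 2 + X * (2 * (EBitsp G + 4) + 2)) + 2))

/-- `eval` of `codeLenp`. [folklore] -/
@[simp] theorem codeLenp_eval (n : ℕ) : (codeLenp G).eval n = LM n (EBits G n) := by simp [codeLenp, LM]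

/-- The query budget bound `n (n + 2 + RB g n (3g+1))` as a polynomial. [folklore] -/
noncomputable def budgetp : Polynomial ℕ := X * (X + 2 + RBp G * C (3 * G + 1))

/-- `eval` of `budgetp`. [folklore] -/
@[simp] theorem budgetp_eval (n : ℕ) : (budgetp G).eval n = n * (n + 2 + RB G n * (3 * G + 1)) := by simp [budgetp]

/-- The radix for the round/pivot component of a site: `q₀ N + RB g (q₀ N) + 1`. [folklore] -/
noncomputable def Rp : Polynomial ℕ := q₀ + (RBp G).comp q₀ + 1

/-- `eval` of `Rp`. [folklore] -/
@[simp] theorem Rp_eval (N : ℕ) : (Rp G q₀).eval N = q₀.eval N + RB G (q₀.eval N) + 1 := by simp [Rp]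

/-- The number of coin blocks per sub-run (a bound for the site index). [folklore] -/
noncomputable def NSp : Polynomial ℕ := (q₀ + 1) * 3 * Rp G q₀ * C (3 * G + 1)

/-- `eval` of `NSp`. [folklore] -/
@[simp] theorem NSp_eval (N : ℕ) :
    (NSp G q₀).eval N = (q₀.eval N + 1) * 3 * (Rp G q₀).eval N * (3 * G + 1) := by simp [NSp]

/-- The total number of coin blocks: `(q₀ N + 1)` sub-runs times `NSp` blocks each (one block of
fresh coins per oracle call; Arora–Barak 2009, §7.4.1). [cite: AroraBarak2009, §7.4.1] -/
noncomputable def QBp : Polynomial ℕ := (q₀ + 1) * NSp G q₀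

/-- `eval` of `QBp`. [folklore] -/
@[simp] theorem QBp_eval (N : ℕ) : (QBp G q₀).eval N = (q₀.eval N + 1) * (NSp G q₀).eval N := by simp [QBp]

/-- The confidence parameter `k = 3 · #blocks` (each oracle call fails with probability `≤ 1/k`, so
all calls are good except with probability `≤ 1/3`, by the union bound; Arora–Barak 2009, §7.4.1). [cite: AroraBarak2009, §7.4.1] -/
noncomputable def kp : Polynomial ℕ := 3 * QBp G q₀

/-- `eval` of `kp`. [folklore] -/
@[simp] theorem kp_eval (N : ℕ) : (kp G q₀).eval N = 3 * (QBp G q₀).eval N := by simp [kp]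

/-- The maximal code length of a matrix asked in a sub-run (dimension `≤ q₀ N`). [folklore] -/
noncomputable def Lmaxp : Polynomial ℕ := (codeLenp G).comp q₀

/-- `eval` of `Lmaxp`. [folklore] -/
@[simp] theorem Lmaxp_eval (N : ℕ) : (Lmaxp G q₀).eval N = LM (q₀.eval N) (EBits G (q₀.eval N)) := by simp [Lmaxp]

/-- The coin block length `ℓ = c(Lmax + k)` (the coin demand of the randomised oracle,
`PerSqRandOracleSolves`). [cite: AaronsonArkhipovToC2013, Def. 2.4 (p. 163) with proof of Thm. 1.1 (p. 178)] -/
noncomputable def ellp : Polynomial ℕ := c.comp (Lmaxp G q₀ + kp G q₀)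

/-- `eval` of `ellp`. [folklore] -/
@[simp] theorem ellp_eval (N : ℕ) : (ellp G c q₀).eval N = c.eval ((Lmaxp G q₀).eval N + (kp G q₀).eval N) := by
  simp [ellp]

/-- The total coin length `#blocks · ℓ` of the `BPP` machine. [cite: AroraBarak2009, §7.4.1] -/
noncomputable def Pp : Polynomial ℕ := QBp G q₀ * ellp G c q₀

/-- `eval` of `Pp`. [folklore] -/
@[simp] theorem Pp_eval (N : ℕ) : (Pp G c q₀).eval N = (QBp G q₀).eval N * (ellp G c q₀).eval N := by simp [Pp]

/-- **The block index of a call site** within a sub-run (mixed radix over (level, phase, round,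
index); injective on the box of `sites_perLevel`, `siteIdx_inj`, and `< NSp`, `siteIdx_lt`). [folklore] -/
noncomputable def siteIdx (N : ℕ) (s : Site) : ℕ :=
  ((s.1 * 3 + s.2.1) * (Rp G q₀).eval N + s.2.2.1) * (3 * G + 1) + s.2.2.2

variable {G q₀}

/-- Mixed-radix uniqueness. [folklore] -/
theorem radix_inj {W a b a' b' : ℕ} (hb : b < W) (hb' : b' < W) (h : a * W + b = a' * W + b') : a = a' ∧ b = b' := by
  have hW : 0 < W := by omega
  have h1 : (a * W + b) / W = a := by rw [Nat.add_comm, Nat.add_mul_div_right _ _ hW, Nat.div_eq_of_lt hb, zero_add]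
  have h2 : (a' * W + b') / W = a' := by rw [Nat.add_comm, Nat.add_mul_div_right _ _ hW, Nat.div_eq_of_lt hb', zero_add]
  have ha : a = a' := by rw [← h1, ← h2, h]
  subst ha
  exact ⟨rfl, by omega⟩

/-- The components of a site in the box `InSiteBox g n`, `n ≤ q₀ N`, are below the radices. [folklore] -/
theorem site_lt_of_inSiteBox (hG : 1 ≤ G) {N n : ℕ} (hn : n ≤ q₀.eval N) {s : Site} (hs : InSiteBox G n s) :
    s.1 ≤ q₀.eval N ∧ s.2.1 < 3 ∧ s.2.2.1 < (Rp G q₀).eval N ∧ s.2.2.2 < 3 * G + 1 := by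
  obtain ⟨_, h1, h2, h3, h4⟩ := hs
  have hr : rounds G n ≤ RB G (q₀.eval N) := (rounds_le_RB hG n).trans (RB_mono hn)
  rw [Rp_eval]
  omega

/-- **The block index is below `NSp`** for sites in the box. [folklore] -/
theorem siteIdx_lt (hG : 1 ≤ G) {N n : ℕ} (hn : n ≤ q₀.eval N) {s : Site} (hs : InSiteBox G n s) :
    siteIdx G q₀ N s < (NSp G q₀).eval N := by
  obtain ⟨h1, h2, h3, h4⟩ := site_lt_of_inSiteBox hG hn hs
  rw [NSp_eval]
  unfold siteIdx
  set R := (Rp G q₀).eval N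
  set W := 3 * G + 1
  have hA : s.1 * 3 + s.2.1 < (q₀.eval N + 1) * 3 := by nlinarith
  have hB : (s.1 * 3 + s.2.1) * R + s.2.2.1 < (q₀.eval N + 1) * 3 * R := by
    have : (s.1 * 3 + s.2.1 + 1) * R ≤ (q₀.eval N + 1) * 3 * R := Nat.mul_le_mul_right _ hA
    nlinarith
  have : (((s.1 * 3 + s.2.1) * R + s.2.2.1) + 1) * W ≤ (q₀.eval N + 1) * 3 * R * W := Nat.mul_le_mul_right _ hB
  nlinarith

/-- **The block index is injective** on the sites in the box. [folklore] -/
theorem siteIdx_inj (hG : 1 ≤ G) {N n n' : ℕ} (hn : n ≤ q₀.eval N) (hn' : n' ≤ q₀.eval N) {s s' : Site}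
    (hs : InSiteBox G n s) (hs' : InSiteBox G n' s') (h : siteIdx G q₀ N s = siteIdx G q₀ N s') : s = s' := by
  obtain ⟨_, h2, h3, h4⟩ := site_lt_of_inSiteBox hG hn hs
  obtain ⟨_, h2', h3', h4'⟩ := site_lt_of_inSiteBox hG hn' hs'
  unfold siteIdx at h
  obtain ⟨hx, hd⟩ := radix_inj h4 h4' h
  obtain ⟨hy, hc⟩ := radix_inj h3 h3' hx
  obtain ⟨ha, hb⟩ := radix_inj h2 h2' hy
  obtain ⟨a, b, cc, d⟩ := s
  obtain ⟨a', b', cc', d'⟩ := s'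
  simp only at ha hb hc hd
  simp [ha, hb, hc, hd]

/-- `NSp` is positive. [folklore] -/
theorem NSp_pos (N : ℕ) : 0 < (NSp G q₀).eval N := by
  rw [NSp_eval, Rp_eval]; positivity

/-- `QBp` is positive. [folklore] -/
theorem QBp_pos (N : ℕ) : 0 < (QBp G q₀).eval N := by
  rw [QBp_eval]; exact Nat.mul_pos (Nat.succ_pos _) (NSp_pos N)

end Params

/-! ### The randomised search as an oracle computation -/

section RandComp

variable (G : ℕ) (c q₀ : Polynomial ℕ)

/-- The `j`-th block of length `ℓ` of a coin string (fresh coins for the `j`-th call). [cite: AroraBarak2009, §7.4.1] -/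
def chunk (ℓ j : ℕ) (r : List Bool) : List Bool := (r.drop (j * ℓ)).take ℓ

/-- Reading the decorated query `u = ⟨⟨x, r⟩, ⟨listBool as, y⟩⟩` of the `BPP` machine: the outer
input `x`. [folklore] -/
def inX (u : List Bool) : List Bool := (boolUnpair (boolUnpair u).1).1

/-- … the coin string `r`. [folklore] -/
def inR (u : List Bool) : List Bool := (boolUnpair (boolUnpair u).1).2

/-- … the outer round `i = |as|` (the unary length field of `listBool as`). [folklore] -/
def inI (u : List Bool) : ℕ := unaryDecodeNat (boolUnpair (boolUnpair (boolUnpair u).2).1).1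

/-- … the outer query `y` (a matrix code). [folklore] -/
def inY (u : List Bool) : List Bool := (boolUnpair (boolUnpair u).2).2

/-- **The coin map of sub-run `i`**: the canonical query at site `s` for the matrix `M` becomes the
`Per²`-query `⟨⟨M, 1^k⟩, block_{i · NS + siteIdx s}(r)⟩` — the randomised oracle is "a deterministic
algorithm that takes a random string as part of its input" (AA13 Thm. 1.1, p. 149), and each call
site of each sub-run is given its own block of the `BPP` machine's coins (Arora–Barak 2009,
§7.4.1). [cite: AaronsonArkhipovToC2013, Thm. 1.1 (p. 149)] [cite: AroraBarak2009, §7.4.1] -/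
noncomputable def coinMap (x r : List Bool) (i : ℕ) (q : List Bool) : List Bool :=
  match canonMat q with
  | none => []
  | some M => perSqQuery M.2 ((kp G q₀).eval x.length)
      (chunk ((ellp G c q₀).eval x.length) (i * (NSp G q₀).eval x.length + siteIdx G q₀ x.length (canonSite q)) r)

/-- The coin map on a canonical query. [folklore] -/
@[simp] theorem coinMap_canon (x r : List Bool) (i : ℕ) (s : Site) (M : Σ n : ℕ, Fin n → Fin n → ℤ) :
    coinMap G c q₀ x r i (canon s M) = perSqQuery M.2 ((kp G q₀).eval x.length)
      (chunk ((ellp G c q₀).eval x.length) (i * (NSp G q₀).eval x.length + siteIdx G q₀ x.length s) r) := by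
  simp [coinMap]

/-- **The randomised search on a decorated query** `u = ⟨⟨x, r⟩, ⟨listBool as, y⟩⟩`: if `y` codes a
`0/1` matrix `X` of dimension `n`, run the AA13 search for `Per X` with the canonical queries
relabelled by the coin map of sub-run `|as|`, and answer `min(result, n!)` in binary (on a good run
the result is `Per X ≤ n!`); otherwise answer `encodeNat 0 = []`, as the exact `0/1`-permanent
oracle does. [cite: AaronsonArkhipovToC2013, proof of Thm. 4.3 (pp. 176–177) with proof of Thm. 1.1 (p. 178)] -/
noncomputable def randComp (u : List Bool) : OracleComp (List Bool) :=
  match encodingIntMatrix.decode (inY u) with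
  | none => OracleComp.pure []
  | some M =>
    if isZeroOneEntries M then
      OracleComp.bind (relabel (coinMap G c q₀ (inX u) (inR u) (inI u)) (perLevel canon G M.1 (Matrix.of M.2)))
        fun v => OracleComp.pure (encodeNat (min v M.1.factorial))
    else OracleComp.pure []

/-- The randomised search as an oracle algorithm (transcript step function of `randComp`). [cite: AaronsonArkhipovToC2013, proof of Thm. 4.3 (p. 176) with Thm. 1.1 (p. 149)] -/
noncomputable def randSearchAlg : OracleAlg (List Bool) := toOracleAlg (randComp G c q₀)

/-- The function computed by the randomised search against the oracle `O`. [cite: AaronsonArkhipovToC2013, proof of Thm. 4.3 (p. 176) with Thm. 1.1 (p. 149)] -/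
noncomputable def randFn (O : Oracle) (u : List Bool) : List Bool := eval O (randComp G c q₀ u)

end RandComp

/-- **Named fact (the machine-level content of AA13's "in polynomial time", proof of Thm. 4.3):
the randomised search is a polynomial-time oracle algorithm** — its transcript step function
(decode the decorated query; replay the search `perLevel` of `PermanentSearch.lean` along the
answers received, with exact rational arithmetic on the grid points `X^{[r]}`, whose sizes stay
polynomial on every run by the size invariant `SzInv`/`perLevel_QB`; splice the coin block of the
current call site into the query) is polynomial-time computable in the sense of
`OracleAlg.IsPolyTime`. Aaronson–Arkhipov, proof of Thm. 4.3 (p. 176): "we can compute `Per(X)`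
exactly, in polynomial time and using `O(g n² log n)` adaptive queries"; the query count
(`queryCount_perLevel_le`, `budget_le`) and the sizes (`queries_perLevel_bounded`) are proved, the
Turing-machine running time of the step function is what this `Prop` records. A discharge is a
`TM2ComputableInPolyTime` implementation of `toStep (randComp G c q₀ u)` (big-rational arithmetic,
`Nat.sqrt`, `Nat.log`, factorials, list surgery) with the tree's machine toolkit. [cite: AaronsonArkhipovToC2013, Thm. 4.3, proof ("in polynomial time") (p. 176)] -/
def randSearchAlg_isPolyTime : Prop :=
  ∀ (G : ℕ) (c q₀ : Polynomial ℕ), (randSearchAlg G c q₀).IsPolyTime (encodingList Bool)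

/-! ### The randomised search computes an `FP^O` function -/

section FPRelPart

variable (G : ℕ) (c q₀ : Polynomial ℕ)

/-- `0/1`-ness read off the Boolean test. [folklore] -/
theorem isZeroOne_of_isZeroOneEntries {M : Σ n : ℕ, Fin n → Fin n → ℤ} (h : isZeroOneEntries M = true) :
    IsZeroOne (Matrix.of M.2) := by
  have h' : ∀ i j, M.2 i j = 0 ∨ M.2 i j = 1 := by simpa [isZeroOneEntries] using h
  intro a b
  exact h' a b

/-- The three shapes of the randomised search: trivial (`[]`), or the relabelled search for a `0/1`
matrix followed by the clamped binary answer. [folklore] -/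
theorem randComp_cases (u : List Bool) :
    randComp G c q₀ u = OracleComp.pure [] ∨
      ∃ (n : ℕ) (X : Fin n → Fin n → ℤ), encodingIntMatrix.decode (inY u) = some ⟨n, X⟩ ∧ IsZeroOne (Matrix.of X) ∧
        randComp G c q₀ u =
          OracleComp.bind (relabel (coinMap G c q₀ (inX u) (inR u) (inI u)) (perLevel canon G n (Matrix.of X)))
            fun v => OracleComp.pure (encodeNat (min v n.factorial)) := by
  unfold randComp
  cases h : encodingIntMatrix.decode (inY u) with
  | none => left; rfl
  | some M =>
    by_cases h01 : isZeroOneEntries M = true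
    · right
      exact ⟨M.1, M.2, rfl, isZeroOne_of_isZeroOneEntries h01, by simp [h01]⟩
    · left; simp [h01]

/-- `n! < 2^{n² + 1}`. [folklore] -/
theorem factorial_lt_two_pow_sq_succ : ∀ n : ℕ, n.factorial < 2 ^ (n ^ 2 + 1)
  | 0 => by simp
  | n + 1 => (factorial_succ_lt_two_pow_sq n).trans_le (Nat.pow_le_pow_right (by norm_num) (Nat.le_succ _))

/-- **The answers of the randomised search are short**: `|randFn u| ≤ |y|² + 1` for the matrix code
`y` inside `u`. [folklore] -/
theorem length_randFn_le (O : Oracle) (u : List Bool) : (randFn G c q₀ O u).length ≤ (inY u).length ^ 2 + 1 := by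
  unfold randFn
  rcases randComp_cases G c q₀ u with h | ⟨n, X, hdec, _, h⟩
  · rw [h]; simp
  · rw [h, eval_bind, eval_pure]
    have hn : n ≤ (inY u).length := dim_le_length_of_decode hdec
    refine (length_encodeNat_le_of_lt_two_pow ((min_le_right _ _).trans_lt (factorial_lt_two_pow_sq_succ n))).trans ?_
    have : n ^ 2 ≤ (inY u).length ^ 2 := Nat.pow_le_pow_left hn 2
    omega

/-- The components read off `u` are not longer than `u`. [folklore] -/
theorem length_inX_le (u : List Bool) : (inX u).length ≤ u.length := by
  unfold inX
  have h1 := length_boolUnpair_parts_le u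
  have h2 := length_boolUnpair_parts_le (boolUnpair u).1
  omega

/-- The components read off `u` are not longer than `u`. [folklore] -/
theorem length_inY_le (u : List Bool) : (inY u).length ≤ u.length := by
  unfold inY
  have h1 := length_boolUnpair_parts_le u
  have h2 := length_boolUnpair_parts_le (boolUnpair u).2
  omega

/-- A chunk is at most `ℓ` long. [folklore] -/
theorem length_chunk_le (ℓ j : ℕ) (r : List Bool) : (chunk ℓ j r).length ≤ ℓ := by
  unfold chunk; exact List.length_take_le _ _

/-- Length of a `Per²`-query. [folklore] -/
theorem length_perSqQuery {m : ℕ} (M : Fin m → Fin m → ℤ) (k : ℕ) (v : List Bool) :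
    (perSqQuery M k v).length = 2 * (2 * (encodingIntMatrix.encode ⟨m, M⟩).length + 2 + k) + 2 + v.length := by
  have hk : (unaryEncodeNat k).length = k := unary_decode_encode_nat k
  simp only [perSqQuery, length_boolPair, hk]

/-- **The randomised search asks polynomially many queries**: `≤ budgetp G (|u|)`. [cite: AaronsonArkhipovToC2013, proof of Thm. 4.3 (p. 176)] -/
theorem queryCount_randComp_le (hG : 1 ≤ G) (O : Oracle) (u : List Bool) :
    queryCount O (randComp G c q₀ u) ≤ (budgetp G).eval u.length := by
  rcases randComp_cases G c q₀ u with h | ⟨n, X, hdec, _, h⟩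
  · rw [h]; simp
  · rw [h, queryCount_bind, queryCount_relabel, queryCount_pure, add_zero]
    have hn : n ≤ u.length := (dim_le_length_of_decode hdec).trans (length_inY_le u)
    refine (queryCount_perLevel_le canon G n _ _).trans ((budget_le hG n).trans ?_)
    rw [← budgetp_eval]
    exact TM2Iter.eval_mono _ hn

/-- **The queries of the randomised search are polynomially long.** [cite: AaronsonArkhipovToC2013, proof of Thm. 4.3 (pp. 176–177)] -/
theorem length_le_of_mem_queryList_randComp (hG : 1 ≤ G) (O : Oracle) (u : List Bool) {y : List Bool}
    (hy : y ∈ queryList O (randComp G c q₀ u)) :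
    y.length ≤ 4 * (codeLenp G).eval u.length + 2 * (kp G q₀).eval u.length + (ellp G c q₀).eval u.length + 6 := by
  rcases randComp_cases G c q₀ u with h | ⟨n, X, hdec, h01, h⟩
  · rw [h] at hy; simp at hy
  · rw [h, queryList_bind_eq, queryList_relabel, queryList_pure_eq, List.append_nil] at hy
    obtain ⟨q, hq, rfl⟩ := List.mem_map.1 hy
    obtain ⟨i, m, M, rfl, h1, h2, h3⟩ := queries_perLevel_bounded hG h01 _ hq
    rw [coinMap_canon, length_perSqQuery]
    dsimp only
    have hn : n ≤ u.length := (dim_le_length_of_decode hdec).trans (length_inY_le u)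
    have hx : (inX u).length ≤ u.length := length_inX_le u
    have hcode : (encodingIntMatrix.encode ⟨m, M⟩).length ≤ (codeLenp G).eval u.length := by
      rw [codeLenp_eval]; exact h3.trans (LM_mono hn (EBits_mono hn))
    have hk : (kp G q₀).eval (inX u).length ≤ (kp G q₀).eval u.length := TM2Iter.eval_mono _ hx
    have hl : (chunk ((ellp G c q₀).eval (inX u).length)
        (inI u * (NSp G q₀).eval (inX u).length + siteIdx G q₀ (inX u).length i) (inR u)).length ≤
        (ellp G c q₀).eval u.length := (length_chunk_le _ _ _).trans (TM2Iter.eval_mono _ hx)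
    omega

/-- The round/length polynomial of the randomised search as an `FP^O` machine. [folklore] -/
noncomputable def qSp : Polynomial ℕ := budgetp G + 1 + 4 * codeLenp G + 2 * kp G q₀ + ellp G c q₀ + 6

/-- **The randomised search computes `randFn` in `FP^O`** (given the running-time fact): the
transcript machine returns `eval` within `budget + 1` rounds (`run_toOracleAlg`), asking the
polynomially long queries of `queryList` (`queries_toOracleAlg`). [cite: AaronsonArkhipovToC2013, proof of Thm. 4.3 (p. 176) with proof of Thm. 1.1 (p. 178)] -/
theorem randFn_mem_FPRel (hPT : randSearchAlg_isPolyTime) (hG : 1 ≤ G) (O : Oracle) :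
    randFn G c q₀ O ∈ FPRel O := by
  refine ⟨randSearchAlg G c q₀, hPT G c q₀, qSp G c q₀, fun u => ?_⟩
  have hcnt : queryCount O (randComp G c q₀ u) < (qSp G c q₀).eval u.length := by
    have := queryCount_randComp_le G c q₀ hG O u
    simp only [qSp, eval_add, eval_one, eval_mul, eval_ofNat]
    omega
  refine ⟨run_toOracleAlg _ O u hcnt, fun y hy => ?_⟩
  rw [randSearchAlg, queries_toOracleAlg _ O u hcnt] at hy
  have := length_le_of_mem_queryList_randComp G c q₀ hG O u hy
  simp only [qSp, eval_add, eval_one, eval_mul, eval_ofNat]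
  omega

end FPRelPart

/-! ### The `BPP` machine: the outer `P^{Per}` machine with decorated queries -/

section Outer

variable (G : ℕ) (c q₀ : Polynomial ℕ) (O : Oracle) (M₀ : OracleAlg Bool)

/-- **The deterministic part of the `BPP^O` machine** on input `w = ⟨x, r⟩`: run the `P^{Per}`
machine `M₀` on `x` (queries capped at `q₀(|x|)`, as they are against the true permanent oracle),
decorating its `i`-th query `y` as `⟨w, ⟨listBool (answers so far), y⟩⟩` — so that the oracle
answering it (the randomised search `randFn`) knows the coins `r` and the sub-run index `i` — and
clock the whole at `q₀(|w|)` rounds. [cite: AaronsonArkhipovToC2013, proof of Thm. 1.1 (p. 178)] -/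
noncomputable def Kalg : OracleAlg Bool :=
  ((((M₀.capQ q₀ false).comap fun z => (boolUnpair z).1).mapQuery id).clock q₀ false)

/-- The language decided by `Kalg` with the randomised search as its oracle: the `L' ∈ P^O` of the
`BP·` operator (`bp`). [cite: AaronsonArkhipovToC2013, proof of Thm. 1.1 (p. 178)] -/
def Lrand : Language Bool :=
  {w | (Kalg q₀ M₀).run (randFn G c q₀ O) (q₀.eval w.length + 1) w = some true}

variable {M₀}

/-- `Kalg` is polynomial-time when `M₀` is (closure of `IsPolyTime` under cap, comap, query map and
clock, `OracleQueryMap.lean`). [cite: AroraBarak2009, §3.4] -/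
theorem isPolyTime_Kalg (hM₀ : M₀.IsPolyTime encodingBoolBool) : (Kalg q₀ M₀).IsPolyTime encodingBoolBool :=
  OracleAlg.isPolyTime_clock _
    (OracleAlg.isPolyTime_mapQuery _
      (OracleAlg.isPolyTime_comap _ (OracleAlg.isPolyTime_capQ _ hM₀ q₀ false) boolUnpairFst_mem_FP)
      (PolyTimeComputable.id _)) q₀ false

/-- **The shape of the queries of `Kalg`** (against any oracle): `⟨w, ⟨listBool as, y₀⟩⟩` with
`|y₀| ≤ q₀(|w|)` (the cap), `|as| < q₀(|w|)` (the clock), and every entry of `as` an answer of the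
oracle to an earlier query of the same run. [cite: AroraBarak2009, §3.4] -/
theorem mem_queries_Kalg (f : Oracle) {n : ℕ} {w y : List Bool} (hy : y ∈ (Kalg q₀ M₀).queries f n w) :
    ∃ (as : List (List Bool)) (y₀ : List Bool),
      y = boolPair w (boolPair ((encodingList Bool).listBool.encode as) y₀) ∧ y₀.length ≤ q₀.eval w.length ∧
        as.length < q₀.eval w.length ∧ ∀ a ∈ as, ∃ y' ∈ (Kalg q₀ M₀).queries f n w, a = f y' := by
  obtain ⟨as, hstep, has⟩ := OracleAlg.exists_step_of_mem_queries _ f n w hy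
  rw [Kalg, OracleAlg.clock_step] at hstep
  split_ifs at hstep with hlen
  rw [OracleAlg.mapQuery_step] at hstep
  cases hs : ((M₀.capQ q₀ false).comap fun z => (boolUnpair z).1).step w as with
  | inr b => rw [hs] at hstep; cases hstep
  | inl y₀ =>
    rw [hs] at hstep
    simp only [Sum.inl.injEq, id] at hstep
    refine ⟨as, y₀, hstep.symm, ?_, hlen, has⟩
    rw [OracleAlg.comap_step] at hs
    refine (OracleAlg.capQ_step_eq_inl hs).trans (TM2Iter.eval_mono _ ?_)
    have := length_boolUnpair_parts_le w
    omega

/-- The answers received by `Kalg` from the randomised search are short: `≤ q₀(|w|)² + 1`. [folklore] -/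
theorem length_answer_Kalg_le {n : ℕ} {w y' : List Bool} (hy' : y' ∈ (Kalg q₀ M₀).queries (randFn G c q₀ O) n w) :
    (randFn G c q₀ O y').length ≤ (q₀.eval w.length) ^ 2 + 1 := by
  obtain ⟨as, y₀, rfl, hy₀, _, _⟩ := mem_queries_Kalg q₀ (randFn G c q₀ O) hy'
  refine (length_randFn_le G c q₀ O _).trans ?_
  have hin : inY (boolPair w (boolPair ((encodingList Bool).listBool.encode as) y₀)) = y₀ := by simp [inY]
  rw [hin]
  have := Nat.pow_le_pow_left hy₀ 2
  omega

/-- The round/query-length polynomial of `Kalg`. [folklore] -/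
noncomputable def qKp : Polynomial ℕ := q₀ + 1 + 2 * X + 4 + q₀ + 2 * (2 * q₀ + 2 + q₀ * (2 * (q₀ ^ 2 + 1) + 2))

/-- **The queries of `Kalg` against the randomised search are polynomially long.** [cite: AroraBarak2009, §3.4] -/
theorem length_le_of_mem_queries_Kalg {n : ℕ} {w y : List Bool} (hy : y ∈ (Kalg q₀ M₀).queries (randFn G c q₀ O) n w) :
    y.length ≤ (qKp q₀).eval w.length := by
  obtain ⟨as, y₀, rfl, hy₀, hlen, has⟩ := mem_queries_Kalg q₀ (randFn G c q₀ O) hy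
  set A := (q₀.eval w.length) ^ 2 + 1 with hA
  have hLB : ((encodingList Bool).listBool.encode as).length ≤ 2 * as.length + 2 + as.length * (2 * A + 2) := by
    refine length_listBool_encode_le _ _ A fun a ha => ?_
    obtain ⟨y', hy', rfl⟩ := has a ha
    exact length_answer_Kalg_le G c q₀ O hy'
  have h1 : as.length * (2 * A + 2) ≤ q₀.eval w.length * (2 * A + 2) := Nat.mul_le_mul_right _ hlen.le
  simp only [length_boolPair, qKp, eval_add, eval_mul, eval_pow, eval_X, eval_ofNat, eval_one]
  rw [hA] at h1 hLB
  nlinarith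

/-- **`Lrand ∈ P^{randFn}`**: `Kalg` is polynomial-time, always answers within `q₀(|w|) + 1` rounds
(the clock), and asks polynomially long queries. [cite: AaronsonArkhipovToC2013, proof of Thm. 1.1 (p. 178)] -/
theorem Lrand_mem_PRel (hM₀ : M₀.IsPolyTime encodingBoolBool) : Lrand G c q₀ O M₀ ∈ PRel (randFn G c q₀ O) := by
  refine ⟨Kalg q₀ M₀, isPolyTime_Kalg q₀ hM₀, qKp q₀, fun w => ⟨?_, fun y hy => length_le_of_mem_queries_Kalg G c q₀ O hy⟩⟩
  have hsome : ((Kalg q₀ M₀).run (randFn G c q₀ O) (q₀.eval w.length + 1) w).isSome :=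
    OracleAlg.run_clock_isSome _ q₀ false _ w (Nat.lt_succ_self _)
  obtain ⟨b, hb⟩ := Option.isSome_iff_exists.1 hsome
  have hfuel : q₀.eval w.length + 1 ≤ (qKp q₀).eval w.length := by
    simp only [qKp, eval_add, eval_mul, eval_pow, eval_X, eval_ofNat, eval_one]; omega
  rw [OracleAlg.run_mono _ _ _ hfuel hb]
  congr 1
  by_cases hw : w ∈ Lrand G c q₀ O M₀
  · have hind : (Lrand G c q₀ O M₀).boolIndicator w = true := ((Lrand G c q₀ O M₀).mem_iff_boolIndicator w).1 hw
    rw [hind]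
    have hw' : (Kalg q₀ M₀).run (randFn G c q₀ O) (q₀.eval w.length + 1) w = some true := hw
    rw [hb] at hw'
    exact Option.some.inj hw'
  · have hind : (Lrand G c q₀ O M₀).boolIndicator w = false := ((Lrand G c q₀ O M₀).notMem_iff_boolIndicator w).1 hw
    rw [hind]
    have hw' : (Kalg q₀ M₀).run (randFn G c q₀ O) (q₀.eval w.length + 1) w ≠ some true := hw
    rw [hb] at hw'
    cases b
    · rfl
    · exact absurd rfl hw'

/-- Hence **`Lrand ∈ P^O`** by oracle composition (`randFn ∈ FP^O`, `OracleCompositionMachine.lean`). [cite: AaronsonArkhipovToC2013, proof of Thm. 1.1 (p. 178)] -/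
theorem Lrand_mem_PRel_oracle (hPT : randSearchAlg_isPolyTime) (hG : 1 ≤ G) (hM₀ : M₀.IsPolyTime encodingBoolBool) :
    Lrand G c q₀ O M₀ ∈ PRel O :=
  OracleAlg.PRel_subset_PRel_of_mem_FPRel (randFn_mem_FPRel G c q₀ hPT hG O) (Lrand_mem_PRel G c q₀ O hM₀)

end Outer

/-! ### Good coins: the `BPP` machine simulates the `P^{Per}` machine exactly -/

section GoodCoins

variable (G : ℕ) (c q₀ : Polynomial ℕ) (O : Oracle) (M₀ : OracleAlg Bool)

/-- The free-running transcript of the capped outer machine against the **exact** `0/1`-permanent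
oracle: the reference run that the `BPP` machine reproduces on good coins. [cite: AaronsonArkhipovToC2013, proof of Thm. 1.1 (p. 178)] -/
noncomputable def refTrans (x : List Bool) (i : ℕ) : List (List Bool) :=
  PRelSigma.trans (M₀.capQ q₀ false) (Oracle.ofFun per01Fn) x i

/-- The `i`-th query of the reference run (junk `[]` past the output). [folklore] -/
noncomputable def refQry (x : List Bool) (i : ℕ) : List Bool :=
  PRelSigma.qryOf (M₀.capQ q₀ false) x (refTrans q₀ M₀ x i)

/-- **Good coins** for the outer input `x`: for every sub-run index `i ≤ q₀(|x|)` whose reference query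
codes a `0/1` matrix `X`, the search for `Per X` with the coin map of sub-run `i` has a good run
(every `Per²`-query answered within the factor `G`, AA13 eq. (4.2)). [cite: AaronsonArkhipovToC2013, Thm. 4.3, eq. (4.2) (p. 176)] [cite: AroraBarak2009, §7.4.1] -/
def GoodCoins (x r : List Bool) : Prop :=
  ∀ i < q₀.eval x.length + 1, ∀ (n : ℕ) (X : Fin n → Fin n → ℤ),
    encodingIntMatrix.decode (refQry q₀ M₀ x i) = some ⟨n, X⟩ → IsZeroOne (Matrix.of X) →
      GoodRun canon G (O ∘ coinMap G c q₀ x r i) (perLevel canon G n (Matrix.of X))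

variable {M₀}

/-- The reference query obeys the cap `q₀(|x|)`. [folklore] -/
theorem length_refQry_le (x : List Bool) (i : ℕ) : (refQry q₀ M₀ x i).length ≤ q₀.eval x.length :=
  OracleAlg.length_qryOf_capQ_le M₀ q₀ false x _

/-- Reading the decorated query `⟨⟨x, r⟩, ⟨listBool as, y⟩⟩`. [folklore] -/
theorem in_boolPair (x r y : List Bool) (as : List (List Bool)) :
    inX (boolPair (boolPair x r) (boolPair ((encodingList Bool).listBool.encode as) y)) = x ∧
    inR (boolPair (boolPair x r) (boolPair ((encodingList Bool).listBool.encode as) y)) = r ∧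
    inI (boolPair (boolPair x r) (boolPair ((encodingList Bool).listBool.encode as) y)) = as.length ∧
    inY (boolPair (boolPair x r) (boolPair ((encodingList Bool).listBool.encode as) y)) = y := by
  refine ⟨by simp [inX], by simp [inR], ?_, by simp [inY]⟩
  simp only [inI, boolUnpair_boolPair]
  show unaryDecodeNat (boolUnpair (boolPair (unaryEncodeNat as.length) _)).1 = as.length
  rw [boolUnpair_boolPair, unary_decode_encode_nat]

/-- `encodeNat 0 = []`. [folklore] -/
theorem encodeNat_zero : encodeNat 0 = [] := by decide

/-- **On a good run the randomised search answers as the exact permanent oracle**: for a query `y`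
and coins such that the search for the `0/1` matrix coded by `y` (if any) runs well, `randFn` on the
decorated query `⟨⟨x, r⟩, ⟨listBool as, y⟩⟩` is `encodeNat (per01Fn y)`. [cite: AaronsonArkhipovToC2013, Thm. 4.3, proof (pp. 176–177)] -/
theorem randFn_eq_of_goodRun (hG : 1 ≤ G) (x r y : List Bool) (as : List (List Bool))
    (hgood : ∀ (n : ℕ) (X : Fin n → Fin n → ℤ), encodingIntMatrix.decode y = some ⟨n, X⟩ → IsZeroOne (Matrix.of X) →
      GoodRun canon G (O ∘ coinMap G c q₀ x r as.length) (perLevel canon G n (Matrix.of X))) :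
    randFn G c q₀ O (boolPair (boolPair x r) (boolPair ((encodingList Bool).listBool.encode as) y)) =
      Oracle.ofFun per01Fn y := by
  obtain ⟨hx, hr, hi, hy⟩ := in_boolPair x r y as
  unfold randFn randComp
  rw [hx, hr, hi, hy]
  show _ = encodeNat (per01Fn y)
  unfold per01Fn
  cases hdec : encodingIntMatrix.decode y with
  | none => simp [encodeNat_zero]
  | some M =>
    by_cases h01 : isZeroOneEntries M = true
    · have hX : IsZeroOne (Matrix.of M.2) := isZeroOne_of_isZeroOneEntries h01
      have hrun := hgood M.1 M.2 hdec hX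
      have hcorr := perLevel_correct hG M.1 (Matrix.of M.2) hX _ hrun
      have hPle : (Matrix.of M.2).permanent ≤ M.1.factorial := by
        simpa using permanent_le_factorial (Matrix.of M.2) hX.nonneg hX.le_one
      simp only [h01, if_true, eval_bind, eval_relabel, eval_pure]
      congr 1
      have heq : eval (O ∘ coinMap G c q₀ x r as.length) (perLevel canon G M.1 (Matrix.of M.2)) =
          ((Matrix.of M.2).permanent).toNat := by
        rw [← hcorr, Int.toNat_natCast]
      rw [heq, min_eq_left]
      have := Int.toNat_le_toNat hPle
      simpa using this
    · simp [h01, encodeNat_zero]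

/-- **Good coins give agreement of the oracles along the reference run** (`MapAgree` of
`OracleQueryMap.lean`): at every live round `i` of the capped outer machine, the randomised search
answers the decorated query as the exact permanent oracle answers the query. [cite: AaronsonArkhipovToC2013, proof of Thm. 1.1 (p. 178)] -/
theorem mapAgree_of_goodCoins (hG : 1 ≤ G) {x r : List Bool} {b₀ : Bool}
    (hrun : (M₀.capQ q₀ false).run (Oracle.ofFun per01Fn) (q₀.eval x.length) x = some b₀)
    (hgood : GoodCoins G c q₀ O M₀ x r) :
    OracleAlg.MapAgree ((M₀.capQ q₀ false).comap fun z => (boolUnpair z).1) id (randFn G c q₀ O)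
      (Oracle.ofFun per01Fn) (boolPair x r) := by
  intro i q hprev hstep
  have htr : ∀ j, PRelSigma.trans ((M₀.capQ q₀ false).comap fun z => (boolUnpair z).1) (Oracle.ofFun per01Fn)
      (boolPair x r) j = refTrans q₀ M₀ x j := fun j => by
    rw [OracleAlg.trans_comap, boolUnpair_boolPair]; rfl
  simp only [htr, OracleAlg.comap_step, boolUnpair_boolPair, id] at hprev hstep ⊢
  -- the round is live, hence below the output round `m < q₀(|x|)`
  obtain ⟨m, hm, hmq, hmout⟩ := (PRelSigma.run_eq_some_iff _ _ _ _ _).1 hrun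
  have hi : i < q₀.eval x.length + 1 := by
    by_contra hi
    have hmi : m < i := by omega
    obtain ⟨y, hy⟩ := hprev m hmi
    rw [refTrans] at hy
    rw [hy] at hmout
    cases hmout
  have hq : refQry q₀ M₀ x i = q := PRelSigma.qryOf_eq_of_step_eq hstep
  rw [randFn_eq_of_goodRun G c q₀ O hG x r q (refTrans q₀ M₀ x i) fun n X hdec hX => ?_]
  rw [← hq] at hdec
  have h := hgood i hi n X hdec hX
  have hlen : (refTrans q₀ M₀ x i).length = i := OracleAlg.length_trans _ _ _ i
  rwa [hlen]

/-- **On good coins the `BPP` machine returns the verdict of the `P^{Per}` machine.** [cite: AaronsonArkhipovToC2013, proof of Thm. 1.1 (p. 178)] -/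
theorem run_Kalg_of_goodCoins (hG : 1 ≤ G) {x r : List Bool} {b₀ : Bool}
    (hrun : M₀.run (Oracle.ofFun per01Fn) (q₀.eval x.length) x = some b₀)
    (hcap : ∀ y ∈ M₀.queries (Oracle.ofFun per01Fn) (q₀.eval x.length) x, y.length ≤ q₀.eval x.length)
    (hgood : GoodCoins G c q₀ O M₀ x r) :
    (Kalg q₀ M₀).run (randFn G c q₀ O) (q₀.eval (boolPair x r).length + 1) (boolPair x r) = some b₀ := by
  have hcapQ : (M₀.capQ q₀ false).run (Oracle.ofFun per01Fn) (q₀.eval x.length) x = some b₀ := by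
    rw [(OracleAlg.run_capQ M₀ q₀ false _ x _ hcap).1, hrun]
  have hagree := mapAgree_of_goodCoins G c q₀ O hG hcapQ hgood
  have hK₀ : (((M₀.capQ q₀ false).comap fun z => (boolUnpair z).1).mapQuery id).run (randFn G c q₀ O)
      (q₀.eval (boolPair x r).length) (boolPair x r) = some b₀ := by
    have hxw : q₀.eval x.length ≤ q₀.eval (boolPair x r).length :=
      TM2Iter.eval_mono _ (by rw [length_boolPair]; omega)
    refine OracleAlg.run_mono _ _ _ hxw ?_
    rw [OracleAlg.run_mapQuery _ _ _ _ _ hagree]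
    show OracleAlg.runAux _ _ _ _ [] = _
    rw [OracleAlg.runAux_comap, boolUnpair_boolPair]
    exact hcapQ
  exact OracleAlg.run_clock_of_run _ q₀ false _ _ hK₀ (Nat.le_succ _)

/-- Hence on good coins `⟨x, r⟩ ∈ Lrand ↔ x ∈ L` for the language `L` decided by `M₀` with the exact
permanent oracle. [cite: AaronsonArkhipovToC2013, proof of Thm. 1.1 (p. 178)] -/
theorem mem_Lrand_iff_of_goodCoins (hG : 1 ≤ G) {L : Language Bool} {x r : List Bool}
    (hrun : M₀.run (Oracle.ofFun per01Fn) (q₀.eval x.length) x = some (L.boolIndicator x))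
    (hcap : ∀ y ∈ M₀.queries (Oracle.ofFun per01Fn) (q₀.eval x.length) x, y.length ≤ q₀.eval x.length)
    (hgood : GoodCoins G c q₀ O M₀ x r) : boolPair x r ∈ Lrand G c q₀ O M₀ ↔ x ∈ L := by
  have h := run_Kalg_of_goodCoins G c q₀ O hG hrun hcap hgood
  show (Kalg q₀ M₀).run (randFn G c q₀ O) (q₀.eval (boolPair x r).length + 1) (boolPair x r) = some true ↔ x ∈ L
  rw [h, Option.some.injEq]
  exact (Set.mem_iff_boolIndicator L x).symm

end GoodCoins

/-! ### Bad coins are rare: fresh coins per call site and the union bound -/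

section Probability

variable {G : ℕ} {c q₀ : Polynomial ℕ} {O : Oracle} {M₀ : OracleAlg Bool}

/-- A chunk below the block `j` is read inside the prefix. [folklore] -/
theorem chunk_append_of_lt {ℓ j j' : ℕ} (h : j' < j) (pre rest : List Bool) (hpre : pre.length = j * ℓ) :
    chunk ℓ j' (pre ++ rest) = (pre.drop (j' * ℓ)).take ℓ := by
  have hle : j' * ℓ + ℓ ≤ pre.length := by
    rw [hpre]; have := Nat.mul_le_mul_right ℓ h; rw [Nat.succ_mul] at this; exact this
  unfold chunk
  rw [List.drop_append_of_le_length (by omega), List.take_append_of_le_length]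
  rw [List.length_drop]; omega

/-- A chunk above the block `j` is read inside the suffix. [folklore] -/
theorem chunk_append_of_gt {ℓ j j' : ℕ} (h : j < j') (pre v post : List Bool) (hpre : pre.length = j * ℓ)
    (hv : v.length = ℓ) : chunk ℓ j' (pre ++ v ++ post) = (post.drop (j' * ℓ - (j * ℓ + ℓ))).take ℓ := by
  have hle : j * ℓ + ℓ ≤ j' * ℓ := by
    have := Nat.mul_le_mul_right ℓ h; rw [Nat.succ_mul] at this; exact this
  unfold chunk
  have hlen : (pre ++ v).length = j * ℓ + ℓ := by rw [List.length_append, hpre, hv]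
  rw [show j' * ℓ = (j * ℓ + ℓ) + (j' * ℓ - (j * ℓ + ℓ)) by omega, ← List.drop_drop, List.drop_left' hlen]
  congr 2
  omega

/-- **Coin strings that agree outside the block `j` have the same chunks `j' ≠ j`.** [folklore] -/
theorem chunk_eq_of_ne {ℓ j j' : ℕ} (hj : j' ≠ j) (pre v₁ v₂ post : List Bool) (hpre : pre.length = j * ℓ)
    (h₁ : v₁.length = ℓ) (h₂ : v₂.length = ℓ) :
    chunk ℓ j' (pre ++ v₁ ++ post) = chunk ℓ j' (pre ++ v₂ ++ post) := by
  rcases lt_or_gt_of_ne hj with h | h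
  · rw [List.append_assoc, List.append_assoc, chunk_append_of_lt h pre _ hpre, chunk_append_of_lt h pre _ hpre]
  · rw [chunk_append_of_gt h pre v₁ post hpre h₁, chunk_append_of_gt h pre v₂ post hpre h₂]

/-- The sites asked in a sub-run lie in the box, and the dimension is capped by `q₀(|x|)`:
book-keeping shared by the next two lemmas. [folklore] -/
theorem site_box_of_mem {O' : Oracle} {n : ℕ} {X : Matrix (Fin n) (Fin n) ℤ} {s : Site}
    {M : Σ m : ℕ, Fin m → Fin m → ℤ} (h : canon s M ∈ queryList O' (perLevel canon G n X)) : InSiteBox G n s := by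
  have := (sites_perLevel (g := G) n X O').2 s (List.mem_map.2 ⟨canon s M, h, canonSite_canon s M⟩)
  exact this

/-- **Same block, same matrix**: if two coin strings agree outside the block of the call site `s` of
sub-run `i`, and the searches with the two coin maps both ask a query at site `s`, then they ask the
*same* matrix there — by prefix agreement (`queryList_take_eq_of_agree`: before site `s` is reached
the two runs see the same answers, the other blocks being shared) and distinctness of the sites
(`sites_perLevel`). This is the formal content of "fresh coins for each oracle call".
[Arora–Barak 2009, §7.4.1; Aaronson–Arkhipov 2013, Thm. 1.1 (p. 149: the randomised oracle takes
its random string as part of the input)] [cite: AroraBarak2009, §7.4.1] -/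
theorem matrix_eq_of_agree (hG : 1 ≤ G) {x : List Bool} {n : ℕ} (hn : n ≤ q₀.eval x.length) (X : Matrix (Fin n) (Fin n) ℤ)
    {r₁ r₂ : List Bool} {i : ℕ} {s : Site}
    (hagree : ∀ j', j' ≠ i * (NSp G q₀).eval x.length + siteIdx G q₀ x.length s →
      chunk ((ellp G c q₀).eval x.length) j' r₁ = chunk ((ellp G c q₀).eval x.length) j' r₂)
    {M₁ M₂ : Σ m : ℕ, Fin m → Fin m → ℤ}
    (h₁ : canon s M₁ ∈ queryList (O ∘ coinMap G c q₀ x r₁ i) (perLevel canon G n X))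
    (h₂ : canon s M₂ ∈ queryList (O ∘ coinMap G c q₀ x r₂ i) (perLevel canon G n X)) : M₁ = M₂ := by
  set O₁ := O ∘ coinMap G c q₀ x r₁ i with hO₁
  set O₂ := O ∘ coinMap G c q₀ x r₂ i with hO₂
  set L₁ := queryList O₁ (perLevel canon G n X) with hL₁
  set L₂ := queryList O₂ (perLevel canon G n X) with hL₂
  obtain ⟨hnd₁, hbox₁⟩ := sites_perLevel (g := G) n X O₁
  obtain ⟨hnd₂, hbox₂⟩ := sites_perLevel (g := G) n X O₂
  have hs_box : InSiteBox G n s := site_box_of_mem h₁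
  obtain ⟨t₁, ht₁⟩ := List.mem_iff_getElem?.1 h₁
  have hsite₁ : (L₁.map canonSite)[t₁]? = some s := by rw [List.getElem?_map, ht₁]; simp
  -- the two runs agree before position `t₁`
  have hpref : ∀ s' < t₁, ∀ q, L₁[s']? = some q → O₁ q = O₂ q := by
    intro s' hs' q hq
    simp only [hO₁, hO₂, Function.comp_apply, coinMap]
    cases hM : canonMat q with
    | none => rfl
    | some M =>
      dsimp only
      by_cases hj : i * (NSp G q₀).eval x.length + siteIdx G q₀ x.length (canonSite q) =
          i * (NSp G q₀).eval x.length + siteIdx G q₀ x.length s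
      · exfalso
        have hq_mem : q ∈ L₁ := List.mem_of_getElem? hq
        have hbox_q : InSiteBox G n (canonSite q) := hbox₁ _ (List.mem_map.2 ⟨q, hq_mem, rfl⟩)
        have hsq : canonSite q = s := siteIdx_inj hG hn hn hbox_q hs_box (Nat.add_left_cancel hj)
        have hsite' : (L₁.map canonSite)[s']? = some s := by rw [List.getElem?_map, hq]; simp [hsq]
        have hlt : s' < (L₁.map canonSite).length := (List.getElem?_eq_some_iff.1 hsite').1
        have := (List.getElem?_inj hlt hnd₁).1 (hsite'.trans hsite₁.symm)
        omega
      · rw [hagree _ hj]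
  have ht₁' : L₂[t₁]? = some (canon s M₁) := by
    rw [hL₂, getElem?_queryList_eq_of_agree O₁ O₂ (perLevel canon G n X) t₁ hpref]
    exact ht₁
  obtain ⟨t₂, ht₂⟩ := List.mem_iff_getElem?.1 h₂
  have hsite₂ : (L₂.map canonSite)[t₁]? = some s := by rw [List.getElem?_map, ht₁']; simp
  have hsite₂' : (L₂.map canonSite)[t₂]? = some s := by rw [List.getElem?_map, ht₂]; simp
  have hlt : t₁ < (L₂.map canonSite).length := (List.getElem?_eq_some_iff.1 hsite₂).1
  have ht : t₁ = t₂ := (List.getElem?_inj hlt hnd₂).1 (hsite₂.trans hsite₂'.symm)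
  rw [ht, ht₂, Option.some.injEq] at ht₁'
  exact (canon_inj ht₁').2.symm

/-- The bad event of block `j` given the other coins (`pre` before, `post` after): some sub-run `i` and
call site `s` with block `j` ask a matrix whose `Per²`-query with the block's coins is answered
outside the window (AA13 eq. (4.2)). [cite: AaronsonArkhipovToC2013, Thm. 4.3, eq. (4.2) (p. 176)] [cite: AroraBarak2009, §7.4.1] -/
def BadBlock (G : ℕ) (c q₀ : Polynomial ℕ) (O : Oracle) (M₀ : OracleAlg Bool) (x : List Bool) (j : ℕ)
    (pre post : List Bool) : Set (List Bool) :=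
  {v | ∃ i < q₀.eval x.length + 1, ∃ (s : Site) (n : ℕ) (X : Fin n → Fin n → ℤ) (M : Σ m : ℕ, Fin m → Fin m → ℤ),
    i * (NSp G q₀).eval x.length + siteIdx G q₀ x.length s = j ∧
    encodingIntMatrix.decode (refQry q₀ M₀ x i) = some ⟨n, X⟩ ∧ IsZeroOne (Matrix.of X) ∧
    canon s M ∈ queryList (O ∘ coinMap G c q₀ x (pre ++ v ++ post) i) (perLevel canon G n (Matrix.of X)) ∧
    decodeNat (O (perSqQuery M.2 ((kp G q₀).eval x.length) v)) ∉ perSqWindow (G : ℝ) M.2}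

/-- **Each block is bad with probability `≤ 1/k`**: all coin values in `BadBlock j pre post` concern the
same call (`matrix_eq_of_agree`), whose failure probability over its fresh coins is `≤ 1/k` by the
guarantee of the randomised oracle (`PerSqRandOracleSolves`, AA13 Def. 2.4). [cite: AaronsonArkhipovToC2013, Def. 2.4 (p. 163)] [cite: AroraBarak2009, §7.4.1] -/
theorem uniformProb_badBlock_le (hG : 1 ≤ G)
    (hc : ∀ (n : ℕ) (X : Fin n → Fin n → ℤ) (k ℓ : ℕ), 0 < n → 0 < k →
      c.eval ((encodingIntMatrix.encode ⟨n, X⟩).length + k) ≤ ℓ →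
        uniformProb ℓ {u | decodeNat (O (perSqQuery X k u)) ∉ perSqWindow (G : ℝ) X} ≤ 1 / (k : ℝ))
    (x : List Bool) (j : ℕ) (pre post : List Bool) (hpre : pre.length = j * (ellp G c q₀).eval x.length) :
    uniformProb ((ellp G c q₀).eval x.length) (BadBlock G c q₀ O M₀ x j pre post) ≤
      1 / (((kp G q₀).eval x.length : ℕ) : ℝ) := by
  set N := x.length with hN
  set ℓ := (ellp G c q₀).eval N with hℓ
  set k := (kp G q₀).eval N with hk
  have hkpos : 0 < k := by rw [hk, kp_eval]; exact Nat.mul_pos (by norm_num) (QBp_pos N)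
  by_cases hex : ∃ v, v.length = ℓ ∧ v ∈ BadBlock G c q₀ O M₀ x j pre post
  · obtain ⟨v₁, hv₁, i₁, hi₁, s₁, n₁, X₁, M₁, hj₁, hdec₁, h01₁, hmem₁, hbad₁⟩ := hex
    have hn₁ : n₁ ≤ q₀.eval N := (dim_le_length_of_decode hdec₁).trans (length_refQry_le q₀ x i₁)
    have hbox₁ : InSiteBox G n₁ s₁ := site_box_of_mem hmem₁
    -- every bad value of the block concerns the same matrix `M₁`
    have hsame : ∀ v, v.length = ℓ → v ∈ BadBlock G c q₀ O M₀ x j pre post →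
        v ∈ {u | decodeNat (O (perSqQuery M₁.2 k u)) ∉ perSqWindow (G : ℝ) M₁.2} := by
      rintro v hv ⟨i₂, hi₂, s₂, n₂, X₂, M₂, hj₂, hdec₂, h01₂, hmem₂, hbad₂⟩
      have hn₂ : n₂ ≤ q₀.eval N := (dim_le_length_of_decode hdec₂).trans (length_refQry_le q₀ x i₂)
      have hbox₂ : InSiteBox G n₂ s₂ := site_box_of_mem hmem₂
      obtain ⟨hi, hσ⟩ := radix_inj (siteIdx_lt hG hn₁ hbox₁) (siteIdx_lt hG hn₂ hbox₂) (hj₁.trans hj₂.symm)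
      subst hi
      rw [hdec₁] at hdec₂
      cases hdec₂
      have hs : s₁ = s₂ := siteIdx_inj hG hn₁ hn₁ hbox₁ hbox₂ hσ
      subst hs
      have hM : M₁ = M₂ :=
        matrix_eq_of_agree hG hn₁ (Matrix.of X₁)
          (fun j' hj' => chunk_eq_of_ne (hj₁ ▸ hj') pre v₁ v post hpre hv₁ hv) hmem₁ hmem₂
      subst hM
      exact hbad₂
    refine (uniformProb_mono_of_length' hsame).trans ?_
    -- the guarantee of the randomised oracle for the matrix `M₁`
    obtain ⟨i', m, M, hcanon, hm1, hmn, hcode⟩ := queries_perLevel_bounded hG h01₁ _ hmem₁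
    obtain ⟨-, hMM⟩ := canon_inj hcanon
    subst hMM
    refine hc m M k ℓ hm1 hkpos ?_
    rw [hℓ, ellp_eval, Lmaxp_eval]
    refine TM2Iter.eval_mono c (Nat.add_le_add_right (hcode.trans (LM_mono hn₁ (EBits_mono hn₁))) _)
  · push Not at hex
    have h0 : uniformProb ℓ (BadBlock G c q₀ O M₀ x j pre post) ≤ uniformProb ℓ ∅ :=
      uniformProb_mono_of_length' fun y hy hyB => (hex y hy hyB).elim
    rw [uniformProb_empty] at h0
    exact h0.trans (by positivity)

/-- **Bad coins are rare**: the coins of length `#blocks · ℓ` that are not good for `x` have probability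
`≤ #blocks / k = 1/3` (union bound over the blocks, `uniformProb_exists_badBlock_le'`, each bad with
probability `≤ 1/k` given the others, `uniformProb_badBlock_le`). [Arora–Barak 2009, §7.4.1 (union
bound)] [cite: AroraBarak2009, §7.4.1] -/
theorem uniformProb_not_goodCoins_le (hG : 1 ≤ G)
    (hc : ∀ (n : ℕ) (X : Fin n → Fin n → ℤ) (k ℓ : ℕ), 0 < n → 0 < k →
      c.eval ((encodingIntMatrix.encode ⟨n, X⟩).length + k) ≤ ℓ →
        uniformProb ℓ {u | decodeNat (O (perSqQuery X k u)) ∉ perSqWindow (G : ℝ) X} ≤ 1 / (k : ℝ))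
    (x : List Bool) :
    uniformProb ((Pp G c q₀).eval x.length) {r | ¬ GoodCoins G c q₀ O M₀ x r} ≤ 1 / 3 := by
  have hQBpos : 0 < (QBp G q₀).eval x.length := QBp_pos _
  have hQBeq : (QBp G q₀).eval x.length = (q₀.eval x.length + 1) * (NSp G q₀).eval x.length := QBp_eval G q₀ _
  -- bad coins have a bad block
  have hsub : ∀ r : List Bool, r.length = (QBp G q₀).eval x.length * (ellp G c q₀).eval x.length →
      ¬ GoodCoins G c q₀ O M₀ x r →
      r ∈ {r | ∃ j < (QBp G q₀).eval x.length,
        (r.drop (j * (ellp G c q₀).eval x.length)).take ((ellp G c q₀).eval x.length) ∈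
          BadBlock G c q₀ O M₀ x j (r.take (j * (ellp G c q₀).eval x.length))
            (r.drop (j * (ellp G c q₀).eval x.length + (ellp G c q₀).eval x.length))} := by
    intro r _ hbad
    simp only [GoodCoins, not_forall, exists_prop] at hbad
    obtain ⟨i, hi, n, X, hdec, h01, hrun⟩ := hbad
    simp only [GoodRun, not_forall, exists_prop] at hrun
    obtain ⟨s, M, hmem, hout⟩ := hrun
    rw [Function.comp_apply, coinMap_canon] at hout
    have hn : n ≤ q₀.eval x.length := (dim_le_length_of_decode hdec).trans (length_refQry_le q₀ x i)
    have hbox : InSiteBox G n s := site_box_of_mem hmem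
    have hσ : siteIdx G q₀ x.length s < (NSp G q₀).eval x.length := siteIdx_lt hG hn hbox
    have hjQ : i * (NSp G q₀).eval x.length + siteIdx G q₀ x.length s < (QBp G q₀).eval x.length := by
      have h1 : (i + 1) * (NSp G q₀).eval x.length ≤ (q₀.eval x.length + 1) * (NSp G q₀).eval x.length :=
        Nat.mul_le_mul_right _ (by omega)
      rw [Nat.succ_mul] at h1
      omega
    refine ⟨_, hjQ, i, hi, s, n, X, M, rfl, hdec, h01, ?_, hout⟩
    set ℓ := (ellp G c q₀).eval x.length
    set j := i * (NSp G q₀).eval x.length + siteIdx G q₀ x.length s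
    have hr_eq : r.take (j * ℓ) ++ (r.drop (j * ℓ)).take ℓ ++ r.drop (j * ℓ + ℓ) = r := by
      conv_rhs => rw [← List.take_append_drop (j * ℓ) r, ← List.take_append_drop ℓ (r.drop (j * ℓ))]
      rw [List.drop_drop, List.append_assoc]
    rw [hr_eq]
    exact hmem
  calc uniformProb ((Pp G c q₀).eval x.length) {r | ¬ GoodCoins G c q₀ O M₀ x r}
      ≤ uniformProb ((QBp G q₀).eval x.length * (ellp G c q₀).eval x.length)
          {r | ∃ j < (QBp G q₀).eval x.length,
            (r.drop (j * (ellp G c q₀).eval x.length)).take ((ellp G c q₀).eval x.length) ∈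
              BadBlock G c q₀ O M₀ x j (r.take (j * (ellp G c q₀).eval x.length))
                (r.drop (j * (ellp G c q₀).eval x.length + (ellp G c q₀).eval x.length))} := by
        rw [Pp_eval]; exact uniformProb_mono_of_length' hsub
    _ ≤ (QBp G q₀).eval x.length * (1 / (((kp G q₀).eval x.length : ℕ) : ℝ)) :=
        uniformProb_exists_badBlock_le' le_rfl (BadBlock G c q₀ O M₀ x) fun j _ pre post hpre _ =>
          uniformProb_badBlock_le hG hc x j pre post hpre
    _ = 1 / 3 := by
        rw [kp_eval]
        have hQ : (0 : ℝ) < (QBp G q₀).eval x.length := by exact_mod_cast hQBpos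
        push_cast
        field_simp

end Probability

/-! ### Assembly: `P^{Per} ⊆ BPP^O`, AA13 Thm. 4.3 in randomised-oracle form, the corrected S20 -/

section Assembly

/-- **`P^{Per} ⊆ BPP^O` for a coin-taking `Per²`-approximator `O`** (the composition step of the proof
of AA13 Thm. 1.1, p. 178, with the search of Thm. 4.3): for `L ∈ P^{Per}` decided by `M₀` within
`q₀`, the language `Lrand` of the clocked, decorated `M₀` run against the randomised search is in
`P^O` (`Lrand_mem_PRel_oracle`), and for every `x` at least `2/3` of the coin strings of length
`Pp(|x|)` are good (`uniformProb_not_goodCoins_le`), on which `⟨x, r⟩ ∈ Lrand ↔ x ∈ L`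
(`mem_Lrand_iff_of_goodCoins`); so `L ∈ BP·(P^O) = BPP^O`. Hypotheses: the running-time fact
`randSearchAlg_isPolyTime`, a natural factor `G ≥ 1`, and the guarantee of the oracle with coin
polynomial `c` (the body of `PerSqRandOracleSolves G O`). [cite: AaronsonArkhipovToC2013, proof of Thm. 1.1 (p. 178) with Thm. 4.3 (p. 176)] -/
theorem PRel_per01Fn_subset_BPPRel (hPT : randSearchAlg_isPolyTime) {G : ℕ} (hG : 1 ≤ G) {c : Polynomial ℕ}
    {O : Oracle}
    (hc : ∀ (n : ℕ) (X : Fin n → Fin n → ℤ) (k ℓ : ℕ), 0 < n → 0 < k →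
      c.eval ((encodingIntMatrix.encode ⟨n, X⟩).length + k) ≤ ℓ →
        uniformProb ℓ {u | decodeNat (O (perSqQuery X k u)) ∉ perSqWindow (G : ℝ) X} ≤ 1 / (k : ℝ)) :
    PRel (Oracle.ofFun per01Fn) ⊆ BPPRel O := by
  intro L hL
  obtain ⟨M₀, hM₀, q₀, h₀⟩ := hL
  refine ⟨Lrand G c q₀ O M₀, Lrand_mem_PRel_oracle G c q₀ O hPT hG hM₀, Pp G c q₀, fun x => ?_⟩
  have hgood : {r | GoodCoins G c q₀ O M₀ x r} ⊆ {r | boolPair x r ∈ Lrand G c q₀ O M₀ ↔ x ∈ L} :=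
    fun r hr => mem_Lrand_iff_of_goodCoins G c q₀ O hG (h₀ x).1 (h₀ x).2 hr
  have hbad := uniformProb_not_goodCoins_le (q₀ := q₀) (M₀ := M₀) hG hc x
  have hcompl : uniformProb ((Pp G c q₀).eval x.length) {r | GoodCoins G c q₀ O M₀ x r} =
      1 - uniformProb ((Pp G c q₀).eval x.length) {r | ¬ GoodCoins G c q₀ O M₀ x r} := by
    rw [← uniformProb_compl]
    congr 1
    ext r
    simp
  calc (2 : ℝ) / 3 ≤ 1 - uniformProb ((Pp G c q₀).eval x.length) {r | ¬ GoodCoins G c q₀ O M₀ x r} := by linarith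
    _ = uniformProb ((Pp G c q₀).eval x.length) {r | GoodCoins G c q₀ O M₀ x r} := hcompl.symm
    _ ≤ _ := uniformProb_mono_set hgood

/-- The window of a larger factor is larger. [folklore] -/
theorem perSqWindow_mono {g g' : ℝ} (hg : 0 < g) (hgg' : g ≤ g') {n : ℕ} (X : Fin n → Fin n → ℤ) :
    perSqWindow g X ⊆ perSqWindow g' X := by
  rintro z ⟨h1, h2⟩
  have hP : 0 ≤ ((Matrix.of X).permanent : ℝ) ^ 2 := sq_nonneg _
  refine ⟨(div_le_div_of_nonneg_left hP hg hgg').trans h1, h2.trans (mul_le_mul_of_nonneg_right hgg' hP)⟩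

end Assembly

end PerSearch

/-- **AA13 Theorem 4.3 in randomised-oracle form, from Valiant's theorem and the running-time fact**:
`PSharpP_subset_BPPRel_of_perSqRandOracleSolves` (for every real `g ≥ 1` and every coin-taking oracle
that `g`-approximates `Per²` of integer matrices, `P^{#P} ⊆ BPP^O`) follows from
`permanent01_isSharpPHardFun` (Valiant 1979, Thm. 1 = AA13 Thm. 4.2: `P^{#P} ⊆ P^{Per}`,
`PermanentHardness.lean`) and `PerSearch.randSearchAlg_isPolyTime` (the search runs in polynomial
time), everything else — the binary search and its correctness (`PermanentSearch.lean`), its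
polynomial query/size bounds and distinct call sites (`PermanentSearchRuns.lean`), the `BPP`
machine, oracle composition and the fresh-coins/union-bound estimate (this file) — being proved.
(Real factors `g` are rounded up to `G = ⌈g⌉`: a `g`-approximator is a `G`-approximator.) [cite: AaronsonArkhipovToC2013, Thm. 4.3 (p. 176) with Thm. 4.2 (p. 175) and proof of Thm. 1.1 (p. 178)] -/
theorem PSharpP_subset_BPPRel_of_perSqRandOracleSolves_of_facts (hVal : permanent01_isSharpPHardFun)
    (hPT : PerSearch.randSearchAlg_isPolyTime) : PSharpP_subset_BPPRel_of_perSqRandOracleSolves := by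
  intro g O hg hO
  obtain ⟨c, hc⟩ := hO
  have hg0 : 0 < g := by linarith
  have hG1 : 1 ≤ ⌈g⌉₊ := Nat.one_le_ceil_iff.2 hg0
  have hgG : g ≤ (⌈g⌉₊ : ℕ) := Nat.le_ceil g
  have hc' : ∀ (n : ℕ) (X : Fin n → Fin n → ℤ) (k ℓ : ℕ), 0 < n → 0 < k →
      c.eval ((encodingIntMatrix.encode ⟨n, X⟩).length + k) ≤ ℓ →
        uniformProb ℓ {u | decodeNat (O (perSqQuery X k u)) ∉ perSqWindow ((⌈g⌉₊ : ℕ) : ℝ) X} ≤ 1 / (k : ℝ) :=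
    fun n X k ℓ hn hk hℓ =>
      (uniformProb_mono_set (E' := {u | decodeNat (O (perSqQuery X k u)) ∉ perSqWindow g X})
        fun u (hu : decodeNat (O (perSqQuery X k u)) ∉ perSqWindow ((⌈g⌉₊ : ℕ) : ℝ) X) hu' =>
          hu (PerSearch.perSqWindow_mono hg0 hgG X hu')).trans (hc n X k ℓ hn hk hℓ)
  exact (PSharpP_subset_PRel_per01Fn hVal).trans (PerSearch.PRel_per01Fn_subset_BPPRel hPT hG1 hc')

/-- **The corrected S20 from named facts of the literature only**: exact uniform `BosonSampling` by a
classical sampler gives `P^{#P} ⊆ BPP^{NP}` (`PSharpP_subset_BPPRelClass_NP_of_uniformExactBosonSampling`,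
the corrected form of `PSharpP_subset_BPPRelClass_NP_of_exactBosonSampling` of `Sampling.lean`), assuming
exactly: Stockmeyer approximate counting (AA13 Thm. 4.1, `stockmeyerApproxCounting`), Valiant's
theorem (AA13 Thm. 4.2, `permanent01_isSharpPHardFun`), and the two polynomial-running-time facts
`PerSearch.randSearchAlg_isPolyTime` (the search of Thm. 4.3) and `bosonReduction_mem_FP` (the
reduction maps of the proof of Thm. 1.1). [cite: AaronsonArkhipovToC2013, Thm. 1.1 and Cor. 4.5 (p. 178)] -/
theorem PSharpP_subset_BPPRelClass_NP_of_uniformExactBosonSampling_of_AA13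
    (hStock : stockmeyerApproxCounting) (hVal : permanent01_isSharpPHardFun)
    (hPT : PerSearch.randSearchAlg_isPolyTime) (hRed : bosonReduction_mem_FP) :
    PSharpP_subset_BPPRelClass_NP_of_uniformExactBosonSampling :=
  PSharpP_subset_BPPRelClass_NP_of_uniformExactBosonSampling_of_facts''' hStock
    (fun _ _ hf => OracleAlg.PRel_subset_PRel_of_mem_FPRel hf)
    (PSharpP_subset_BPPRel_of_perSqRandOracleSolves_of_facts hVal hPT) hRed

/-- **The original S20 under the same facts, for uniform samplers**: an exact classical
`BosonSampling` sampler *with a polynomial coin budget* gives `P^{#P} ⊆ BPP^{NP}`. (The S20 `Prop`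
itself quantifies over samplers with an arbitrary coin-length function and is therefore not implied;
see `ExactBosonSamplingHardness.lean`, "MISSTATED".) [cite: AaronsonArkhipovToC2013, Thm. 1.1 and Cor. 4.5 (p. 178)] -/
theorem PSharpP_subset_BPPRelClass_NP_of_uniform_sampler
    (hStock : stockmeyerApproxCounting) (hVal : permanent01_isSharpPHardFun)
    (hPT : PerSearch.randSearchAlg_isPolyTime) (hRed : bosonReduction_mem_FP)
    (h : UniformExactBosonSampling) : PSharpP ⊆ BPPRelClass NP :=
  PSharpP_subset_BPPRelClass_NP_of_uniformExactBosonSampling_of_AA13 hStock hVal hPT hRed h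

end Literature.Computability.QuantumComplexity
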